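import Summits.CriticalPhenomena.PercolationContinuityZ3.Theorems.Transplant.FKConnectivityAllQAntipodalTwoSpineRuleR1
import Summits.CriticalPhenomena.PercolationContinuityZ3.Theorems.Transplant.FKConnectivityAllQAntipodalTwoSpinePhiDel
import Summits.CriticalPhenomena.PercolationContinuityZ3.Theorems.Transplant.FKConnectivityAllQAntipodalTwoSpineGroundRows
import Summits.CriticalPhenomena.PercolationContinuityZ3.Theorems.Transplant.FKConnectivityAllQAntipodalTwoSpineIota
import HarnessLib

/-!
# Connectivity correlation inequalities for `φ_{w,q}` — TWO-SPINE word model: the ATOM MOVES of the rule (R2) at the cell level (both Janus values)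

Helper file (`--supports stmt-CriticalPhenomena-4575`), FK sub-lane `prim-bschramm-fk-2` (gen 15/16); builds on p205010 (kernel theorem,
internal audit signed; external expert review pending).  No named facts, no sorries, standard axioms.

Memo `bschramm/FROM-fk-2-g15-TWO-SPINE.md` §11 (R2) / §12 (V2).  For a CRITICAL loser cell `(u, v, true)` (`v` ground, `ᾱ` conducting) the
degree-0 atoms go to `(tgtA0 u, v.map swapLetter, false)` with `tgtA0` = Theorem U on `A∖y` (identity if `α` conducts), the degree-1 atoms
(present when `δ(α) = 1`) to `(tgtA1 u, v.map swapLetter, false)` with `tgtA1` = gen 13's `ι` (identity on X2-neutral words).  Facts: the targets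
are WINNERS (`cellSign_tgtA0/1`), the degree-1 slot exists (`cellDelA_tgtA1`), the root exponent `baseExp` is unchanged (`baseExp_tgtA0/1`), the
`B`-flag is unchanged (`cellDelB_swap`, `…GroundRows`), and both words only go up (`tgtA0/1_spec`, `forall₂_swap_of_ground`).  The mirror case `j = false` applies the same maps to the `B`-word against the row exchange of the ground `A`-word (`cellSign_tgtB0/1`, `baseExp_tgtB0/1`, `cellDelB_tgtB1`).  Injectivity: `phiRun_injective` / `iota_spec`; disjointness from the R1 targets: `…TwoSpineNoCollision`.
[cite: Grimmett2006, §3.8 (pp. 61–62); §3.9 (p. 63)]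
-/

noncomputable section

namespace Summit.CriticalPhenomena.PercolationContinuityZ3.Theorems

namespace FK

namespace TwoSpine

open X2Word

/-! ### The atom moves of the two-spine rule (R2) at the cell level, `j = true` (the mirror case `j = false` exchanges the roles of `A` and `B`) -/

/-- Degree-0 target on the present side: Theorem U on `A∖y` (identity if `α` already conducts). [folklore] -/
def tgtA0 (u : List SLetter) : List SLetter := if rowC (sRowA u) then u else phiRun (false, false) u

/-- Degree-1 target on the present side: gen 13's `ι` (identity on X2-neutral words: `α` conducts and `δ(ᾱ) = 1`). [folklore] -/
def tgtA1 (u : List SLetter) : List SLetter := if rowC (sRowA u) && (rowDel (sRowB u) == 1) then u else sigmaPhi u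

/-- On a ground word the row exchange only raises letters. [folklore] -/
theorem forall₂_swap_of_ground {v : List SLetter} (hv : isGround v = true) :
    List.Forall₂ (fun a b : SLetter => b = a ∨ (a.2 = (false, true) ∧ b = (a.1, true, false))) v (v.map swapLetter) := by
  induction v with
  | nil => exact List.Forall₂.nil
  | cons l v ih =>
    have hl : groundLetter l = true := by simp [isGround] at hv; exact hv.1
    have hv' : isGround v = true := by simp [isGround] at hv ⊢; exact hv.2
    refine List.Forall₂.cons ?_ (ih hv')
    obtain ⟨k, b, bb⟩ := l
    cases k <;> cases b <;> cases bb <;> simp_all [groundLetter, swapLetter]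

/-- **Degree-0 target facts**: for a critical loser (`ᾱ` conducts), `tgtA0 u` conducts in `α`, keeps `corr α + corr ᾱ`, and lies above `u`. [folklore] -/
theorem tgtA0_spec {u : List SLetter} (hab : rowC (sRowB u) = true) :
    rowC (sRowA (tgtA0 u)) = true ∧
    rowCorr (sRowA (tgtA0 u)) + rowCorr (sRowB (tgtA0 u)) = rowCorr (sRowA u) + rowCorr (sRowB u) ∧
    List.Forall₂ (fun a b : SLetter => b = a ∨ (a.2 = (false, true) ∧ b = (a.1, true, false))) u (tgtA0 u) := by
  unfold tgtA0
  rcases Bool.eq_false_or_eq_true (rowC (sRowA u)) with ha | ha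
  · rw [if_pos ha]; exact ⟨ha, rfl, forall₂_lamFlip_refl u⟩
  · have ha' : ¬ (rowC (sRowA u) = true) := by simp [ha]
    rw [if_neg ha']
    exact ⟨(rowC_phiDel ha hab).1, rowCorr_phiDel ha hab, phiRun_forall₂ _ _⟩

/-- **Degree-1 target facts**: for a critical loser with `δ(α) = 1` (`ᾱ` conducts), `tgtA1 u` conducts in `α`, has `δ(ᾱ) = 1` (its degree-1
slot exists), keeps `corr α + corr ᾱ`, and lies above `u`. [folklore] -/
theorem tgtA1_spec {u : List SLetter} (hab : rowC (sRowB u) = true) (hd : rowDel (sRowA u) = 1) :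
    rowC (sRowA (tgtA1 u)) = true ∧ rowDel (sRowB (tgtA1 u)) = 1 ∧
    rowCorr (sRowA (tgtA1 u)) + rowCorr (sRowB (tgtA1 u)) = rowCorr (sRowA u) + rowCorr (sRowB u) ∧
    List.Forall₂ (fun a b : SLetter => b = a ∨ (a.2 = (false, true) ∧ b = (a.1, true, false))) u (tgtA1 u) := by
  unfold tgtA1
  by_cases hn : (rowC (sRowA u) && (rowDel (sRowB u) == 1)) = true
  · rw [if_pos hn]
    simp only [Bool.and_eq_true, beq_iff_eq] at hn
    exact ⟨hn.1, hn.2, rfl, forall₂_lamFlip_refl u⟩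
  · rw [if_neg hn]
    have hl : sIsLoser u = true := by
      rw [sIsLoser_iff]; simp only [Bool.and_eq_true, beq_iff_eq, Bool.not_eq_true']
      refine ⟨⟨hab, hd⟩, ?_⟩
      simpa using hn
    obtain ⟨h1, h2, h3, h4, -⟩ := iota_spec hl
    exact ⟨h1, h2, h3, h4⟩

/-- **The R2 targets are winners** (`j = true`, ground `v`): both the degree-0 and the degree-1 target cells `(tgt, v.map swapLetter, false)`
have sign `+1`. [folklore] -/
theorem cellSign_tgtA0 {u v : List SLetter} (hv : isGround v = true) (hab : rowC (sRowB u) = true) :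
    cellSign false (tgtA0 u) (v.map swapLetter) = 1 := by
  rw [cellSign_false_swap_ground hv, (tgtA0_spec hab).1]; simp [bR]

/-- The degree-1 target cell is a winner. [folklore] -/
theorem cellSign_tgtA1 {u v : List SLetter} (hv : isGround v = true) (hab : rowC (sRowB u) = true) (hd : rowDel (sRowA u) = 1) :
    cellSign false (tgtA1 u) (v.map swapLetter) = 1 := by
  rw [cellSign_false_swap_ground hv, (tgtA1_spec hab hd).1]; simp [bR]

/-- **The R2 moves preserve the root exponent `baseExp`** (total `corr` of the four rows). [folklore] -/
theorem baseExp_tgtA0 {u : List SLetter} (v : List SLetter) (hab : rowC (sRowB u) = true) :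
    baseExp (Mode.o, Mode.o, Mode.o, Mode.o) (tgtA0 u) (v.map swapLetter) = baseExp (Mode.o, Mode.o, Mode.o, Mode.o) u v := by
  rw [baseExp_root, baseExp_root]
  have h1 := (tgtA0_spec hab).2.1; have h2 := rowCorr_swap v
  omega

/-- The degree-1 move preserves `baseExp`. [folklore] -/
theorem baseExp_tgtA1 {u : List SLetter} (v : List SLetter) (hab : rowC (sRowB u) = true) (hd : rowDel (sRowA u) = 1) :
    baseExp (Mode.o, Mode.o, Mode.o, Mode.o) (tgtA1 u) (v.map swapLetter) = baseExp (Mode.o, Mode.o, Mode.o, Mode.o) u v := by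
  rw [baseExp_root, baseExp_root]
  have h1 := (tgtA1_spec hab hd).2.2.1; have h2 := rowCorr_swap v
  omega

/-- **The degree-1 slot of the R2 target exists**: `cellDelA false (tgtA1 u) = 1`. [folklore] -/
theorem cellDelA_tgtA1 {u : List SLetter} (hab : rowC (sRowB u) = true) (hd : rowDel (sRowA u) = 1) :
    cellDelA false (tgtA1 u) = 1 := by
  simp [cellDelA, (tgtA1_spec hab hd).2.1]

/-! ### The mirror case `j = false` (present root `z` on `B`, ground `A`): the same maps applied to the `B`-word -/

/-- With a ground `A`-word, a `j = false` cell has sign `-[rowC β̄]`. [folklore] -/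
theorem cellSign_false_groundA {u : List SLetter} (hu : isGround u = true) (v : List SLetter) :
    cellSign false u v = -bR (rowC (sRowB v)) := by
  unfold cellSign
  rw [rowC_of_allW (sRowA_ground_allW hu), rowCdot_of_allP (sRowB_ground_allP hu)]
  simp [bR]

/-- Against the row exchange of a ground `A`-word, a `j = true` cell has sign `[rowC β]`. [folklore] -/
theorem cellSign_true_swap_groundA {u : List SLetter} (hu : isGround u = true) (v' : List SLetter) :
    cellSign true (u.map swapLetter) v' = bR (rowC (sRowA v')) := by
  unfold cellSign
  rw [sRowA_map_swapLetter, sRowB_map_swapLetter, rowCdot_of_allP (sRowB_ground_allP hu), rowC_of_allW (sRowA_ground_allW hu)]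
  simp [bR]

/-- The `A`-flag is unchanged by the mirror move. [folklore] -/
theorem cellDelA_swap (u : List SLetter) : cellDelA true (u.map swapLetter) = cellDelA false u := by
  simp [cellDelA, sRowA_map_swapLetter]

/-- **Mirror R2 targets are winners** (`j = false`, ground `u`). [folklore] -/
theorem cellSign_tgtB0 {u v : List SLetter} (hu : isGround u = true) (hbb : rowC (sRowB v) = true) :
    cellSign true (u.map swapLetter) (tgtA0 v) = 1 := by
  rw [cellSign_true_swap_groundA hu, (tgtA0_spec hbb).1]; simp [bR]

/-- The mirror degree-1 target cell is a winner. [folklore] -/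
theorem cellSign_tgtB1 {u v : List SLetter} (hu : isGround u = true) (hbb : rowC (sRowB v) = true) (hd : rowDel (sRowA v) = 1) :
    cellSign true (u.map swapLetter) (tgtA1 v) = 1 := by
  rw [cellSign_true_swap_groundA hu, (tgtA1_spec hbb hd).1]; simp [bR]

/-- The mirror moves preserve `baseExp`. [folklore] -/
theorem baseExp_tgtB0 (u : List SLetter) {v : List SLetter} (hbb : rowC (sRowB v) = true) :
    baseExp (Mode.o, Mode.o, Mode.o, Mode.o) (u.map swapLetter) (tgtA0 v) = baseExp (Mode.o, Mode.o, Mode.o, Mode.o) u v := by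
  rw [baseExp_root, baseExp_root]
  have h1 := (tgtA0_spec hbb).2.1; have h2 := rowCorr_swap u
  omega

/-- The mirror degree-1 move preserves `baseExp`. [folklore] -/
theorem baseExp_tgtB1 (u : List SLetter) {v : List SLetter} (hbb : rowC (sRowB v) = true) (hd : rowDel (sRowA v) = 1) :
    baseExp (Mode.o, Mode.o, Mode.o, Mode.o) (u.map swapLetter) (tgtA1 v) = baseExp (Mode.o, Mode.o, Mode.o, Mode.o) u v := by
  rw [baseExp_root, baseExp_root]
  have h1 := (tgtA1_spec hbb hd).2.2.1; have h2 := rowCorr_swap u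
  omega

/-- The degree-1 slot of the mirror target exists: `cellDelB true (tgtA1 v) = 1`. [folklore] -/
theorem cellDelB_tgtB1 {v : List SLetter} (hbb : rowC (sRowB v) = true) (hd : rowDel (sRowA v) = 1) :
    cellDelB true (tgtA1 v) = 1 := by
  simp [cellDelB, (tgtA1_spec hbb hd).2.1]

end TwoSpine

end FK

end Summit.CriticalPhenomena.PercolationContinuityZ3.Theorems
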